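import Mathlib
import HarnessLib
import Summits.Ventures.LatticeQCDFlow.Exactness.NCMCGeneralSpaceKishSampleSize
import Summits.Ventures.LatticeQCDFlow.Exactness.NCMCGeneralSpaceSampleSizeVarianceInflation

/-!
# NCMCGeneralSpaceKishSampleSizeCorrelated — the Kish denominator from CORRELATED forward records:
# identical `P_F` marginals + a variance-inflation factor `C` on bounded observables give
# `E_Q|(1/N)Σ e^{−2W(εᵢ)}/E_F e^{−2W} − 1| ≤ √C·e^{−t/4} + 2√(P₂-tail)` for `N ≥ e^{L₂ + t}`

HONEST FRAMING: exact (Metropolis-corrected) sampling algorithms for lattice gauge theory;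
figures of merit are autocorrelation/cost numbers at stated couplings and volumes; no
continuum-physics claim.

Venture `LatticeQCDFlow` (cell pub-lqcd); FANOUT row 19 (`su2-snf`, GEN-8).  OUR WORK (bookkeeping);
nothing is cited as a fact.  `Exactness/NCMCGeneralSpaceKishSampleSize` (GEN-7) gives the
Chatterjee–Diaconis law of the Kish denominator for INDEPENDENT forward records (proposal `P_F`,
target `P₂ = P_F.tilted(−2W)`, density `ρ₂ = e^{−2W}/E_F e^{−2W}`, exponent `L₂ = KL(P₂ ‖ P_F)`).  The
estimated function is the constant `1` — bounded — so the BOUNDED-CLASS correlated sufficiency law of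
`Exactness/NCMCGeneralSpaceSampleSizeVarianceInflation` applies verbatim to ANY joint law `Q` of `N`
records with `P_F` marginals and a variance-inflation factor `C` on bounded observables (for the
engine's restart chain with a level sampler minorised by the normalised prior law, `C = 2/ε − 1`:
`Exactness/NCMCGeneralSpaceRestartChainSampleSize`; that corollary and the marginals-only NECESSITY
are the companion `Exactness/NCMCGeneralSpaceKishSampleSizeRestartChain`).

* **`CrooksPair.kish_sampleSize_sufficient_of_varianceInflation`** — `e^{−2W} ∈ L¹(P_F)`, ANY
  probability law `Q` on `Fin N → E` with `P_F` marginals and `Var_Q(Σᵢ g(εᵢ)) ≤ C·N·Var_{P_F} g` for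
  bounded measurable `g`; `N ≥ e^{L₂ + t}` ⇒
  `E_Q|(1/N)Σᵢ e^{−2W(εᵢ)}/E_F e^{−2W} − 1| ≤ √C·e^{−t/4} + 2√(P₂{L₂ + t/2 < log ρ₂})`.

Reading (value-free): the Kish denominator needs `N_eff = N/C ≳ e^{L₂}` effective evolutions
(`L₂ ≤ log(E_F e^{−4W}/(E_F e^{−2W})²)` by the GEN-8 append to `…KishSampleSize`).  NOT CLAIMED: any
value of `C`.
-/

namespace Summit.Ventures.LatticeQCDFlow.Exactness.GeneralNCMC

open MeasureTheory ProbabilityTheory Set Filter Finset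
open scoped ENNReal
open Literature.Probability.ImportanceSampling (isEstimate)

variable {Ω E : Type*} [MeasurableSpace Ω] [MeasurableSpace E]

namespace CrooksPair

variable {ν₀ ν₁ : Measure Ω} {κF κR : Kernel Ω E} {s e : E → Ω} {W : E → ℝ}

/-- **KISH DENOMINATOR, SUFFICIENCY, CORRELATED RECORDS (bounded class).**  `e^{−2W} ∈ L¹(P_F)`; a
probability law `Q` of `N` forward records with `P_F` marginals and variance inflation `C ≥ 0` on
bounded measurable observables; `N ≥ e^{L₂ + t}`, `L₂ = KL(P_F.tilted(−2W) ‖ P_F)`.  Then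
`E_Q|(1/N)Σᵢ e^{−2W(εᵢ)}/E_F e^{−2W} − 1| ≤ √C·e^{−t/4} + 2√(P₂{L₂ + t/2 < −2W − log E_F e^{−2W}})`. -/
theorem kish_sampleSize_sufficient_of_varianceInflation [IsFiniteMeasure ν₀] [IsMarkovKernel κF]
    (h0 : ν₀ univ ≠ 0) (h : CrooksPair ν₀ ν₁ κF κR s e W)
    (hint : Integrable (fun ε => Real.exp (-(2 * W ε))) (fwdPathLaw ν₀ κF))
    {N : ℕ} (Q : Measure (Fin N → E)) [IsProbabilityMeasure Q]
    (hmarg : ∀ i : Fin N, Q.map (fun x => x i) = fwdPathLaw ν₀ κF)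
    {C : ℝ} (hC : 0 ≤ C)
    (hvar : ∀ g : E → ℝ, Measurable g → ∀ B' : ℝ, (∀ ε, |g ε| ≤ B') →
      Var[fun x : Fin N → E => ∑ i, g (x i); Q] ≤ C * N * Var[g; fwdPathLaw ν₀ κF])
    {t : ℝ}
    (hN : Real.exp ((∫ ε, (-(2 * W ε)
        - Real.log (∫ ε', Real.exp (-(2 * W ε')) ∂(fwdPathLaw ν₀ κF)))
          ∂((fwdPathLaw ν₀ κF).tilted fun ε => -(2 * W ε))) + t) ≤ N) :
    ∫ x, |(1 / (N : ℝ)) * ∑ i, Real.exp (-(2 * W (x i)))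
          / ∫ ε', Real.exp (-(2 * W ε')) ∂(fwdPathLaw ν₀ κF) - 1| ∂Q
      ≤ Real.sqrt C * Real.exp (-t / 4)
        + 2 * Real.sqrt (((fwdPathLaw ν₀ κF).tilted fun ε => -(2 * W ε))
          {ε | (∫ ε, (-(2 * W ε) - Real.log (∫ ε', Real.exp (-(2 * W ε')) ∂(fwdPathLaw ν₀ κF)))
              ∂((fwdPathLaw ν₀ κF).tilted fun ε => -(2 * W ε))) + t / 2
            < -(2 * W ε) - Real.log (∫ ε', Real.exp (-(2 * W ε')) ∂(fwdPathLaw ν₀ κF))}).toReal := by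
  haveI := isProbabilityMeasure_fwdPathLaw ν₀ h0 κF
  haveI : IsProbabilityMeasure ((fwdPathLaw ν₀ κF).tilted fun ε => -(2 * W ε)) :=
    isProbabilityMeasure_tilted hint
  have hgen := GeneralNCMC.sampleSize_sufficient_of_varianceInflation_bdd (fwdPathLaw ν₀ κF)
    ((fwdPathLaw ν₀ κF).tilted fun ε => -(2 * W ε)) (tilted_absolutelyContinuous _ _)
    (f := fun _ => (1 : ℝ)) measurable_const (B := 1) (fun _ => by simp) Q hmarg hC hvar (t := t)
    (by rwa [integral_log_rnDeriv_sqTilt h0 hint])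
  rw [integral_log_rnDeriv_sqTilt h0 hint] at hgen
  simp only [one_pow, integral_const, probReal_univ, smul_eq_mul, mul_one, Real.sqrt_one,
    one_mul] at hgen
  -- the estimator, up to a `Q`-null set (each record's density is `e^{−2W}/Z₂` `P_F`-a.e.)
  have hae : ∀ᵐ x ∂Q, ∀ i : Fin N,
      (((fwdPathLaw ν₀ κF).tilted fun ε => -(2 * W ε)).rnDeriv (fwdPathLaw ν₀ κF) (x i)).toReal
        = Real.exp (-(2 * W (x i))) / ∫ ε', Real.exp (-(2 * W ε')) ∂(fwdPathLaw ν₀ κF) := by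
    rw [ae_all_iff]
    intro i
    have hq : Measure.QuasiMeasurePreserving (fun x : Fin N → E => x i) Q (fwdPathLaw ν₀ κF) := by
      refine ⟨measurable_pi_apply i, ?_⟩
      rw [hmarg i]
    filter_upwards [hq.ae_eq (h.rnDeriv_sqTilt_ae h0)] with x hx
    have hx' : ((fwdPathLaw ν₀ κF).tilted fun ε => -(2 * W ε)).rnDeriv (fwdPathLaw ν₀ κF) (x i)
        = ENNReal.ofReal (Real.exp (-(2 * W (x i)))
          / ∫ ε', Real.exp (-(2 * W ε')) ∂(fwdPathLaw ν₀ κF)) := hx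
    rw [hx', ENNReal.toReal_ofReal (div_nonneg (Real.exp_pos _).le (integral_exp_pos hint).le)]
  have hint' : (fun x : Fin N → E => |isEstimate (fwdPathLaw ν₀ κF)
        ((fwdPathLaw ν₀ κF).tilted fun ε => -(2 * W ε)) (fun _ => (1 : ℝ)) N x - 1|)
      =ᵐ[Q] fun x => |(1 / (N : ℝ)) * ∑ i, Real.exp (-(2 * W (x i)))
          / ∫ ε', Real.exp (-(2 * W ε')) ∂(fwdPathLaw ν₀ κF) - 1| := by
    filter_upwards [hae] with x hx
    simp only [isEstimate, one_mul]
    rw [Finset.sum_congr rfl fun i _ => hx i]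
  have htail : {ε | (∫ ε, (-(2 * W ε) - Real.log (∫ ε', Real.exp (-(2 * W ε')) ∂(fwdPathLaw ν₀ κF)))
        ∂((fwdPathLaw ν₀ κF).tilted fun ε => -(2 * W ε))) + t / 2
        < Real.log (((fwdPathLaw ν₀ κF).tilted fun ε => -(2 * W ε)).rnDeriv
          (fwdPathLaw ν₀ κF) ε).toReal}
      =ᵐ[(fwdPathLaw ν₀ κF).tilted fun ε => -(2 * W ε)]
        ({ε | (∫ ε, (-(2 * W ε) - Real.log (∫ ε', Real.exp (-(2 * W ε')) ∂(fwdPathLaw ν₀ κF)))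
            ∂((fwdPathLaw ν₀ κF).tilted fun ε => -(2 * W ε))) + t / 2
          < -(2 * W ε) - Real.log (∫ ε', Real.exp (-(2 * W ε')) ∂(fwdPathLaw ν₀ κF))} : Set E) := by
    filter_upwards [(tilted_absolutelyContinuous _ _).ae_eq
      (log_rnDeriv_tilted_left_self hint)] with ε hε
    simp only [eq_iff_iff]
    dsimp only [setOf]
    rw [hε]
  rw [integral_congr_ae hint', measure_congr htail] at hgen
  exact hgen

end CrooksPair

end Summit.Ventures.LatticeQCDFlow.Exactness.GeneralNCMC
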